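import Literature.Geometry.Kaehler.FubiniStudy
import Literature.Geometry.Kaehler.KaehlerProofs
import Literature.Geometry.Kaehler.ManifoldFormsPullback
import HarnessLib

/-!
# Kähler metrics with prescribed Kähler form; pull-back of a Kähler metric along a holomorphic immersion

Topic `Literature/Geometry/Kaehler`. Two constructions of smooth Kähler metrics on a complex
manifold `M` (holomorphic atlas, model `E`):

* `exists_isKaehler_kaehlerForm_eq` — **a closed, smooth, positive real `(1,1)`-form `θ` is the
  Kähler form of a Kähler metric**, with the metric `g(v, w) = θ(v, Jw)` made explicit (Voisin
  (2002), §3.1.1, Lemma 3.3 and (3.1); §3.1.2, Def. 3.6). This is the construction inside the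
  tree's `isKaehlerManifold_of_closed_positive_form` (file `FubiniStudy.lean`), which only records
  the existence statement `IsKaehlerManifold E M`; the proof is the same.
* `exists_isKaehler_inner_eq_pullback` — **the pull-back of a Kähler metric along a holomorphic
  immersion is a Kähler metric**: for a smooth Kähler metric `G` on `M'` and a `C^∞` map
  `ψ : M → M'` with `ℂ`-linear (`dψ ∘ J = J ∘ dψ`) injective differential, there is a smooth
  Kähler metric `g` on `M` with `g(v, w) = G(dψ v, dψ w)` (Voisin (2002), §3.1.3, first example
  p. 70: "the restriction … of a Kähler metric to a complex submanifold is Kähler": its Kähler form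
  is the pull-back `ψ^*ω`, which is closed, of type `(1,1)` and positive on `dψ`-non-degenerate
  vectors).

## References

* C. Voisin, *Hodge Theory and Complex Algebraic Geometry I*, CUP 2002, §3.1.1 Lemma 3.3, §3.1.2
  Def. 3.6, §3.1.3. [cite: VoisinHodgeI2002, §3.1]
* P. Griffiths, J. Harris, *Principles of Algebraic Geometry*, Wiley 1978, pp. 106–109.
-/

noncomputable section

open scoped Manifold ContDiff Topology
open Bundle Set Filter Function Complex

namespace Literature.Geometry.Kaehler

variable {E : Type*} [NormedAddCommGroup E] [NormedSpace ℂ E] [FiniteDimensional ℂ E]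
  {M : Type*} [TopologicalSpace M] [ChartedSpace E M] [IsManifold 𝓘(ℂ, E) ω M]
  [IsManifold 𝓘(ℝ, E) ∞ M]

/-- **A closed, smooth, positive real `(1,1)`-form is the Kähler form of a Kähler metric**, with the
metric explicit: under the hypotheses of `isKaehlerManifold_of_closed_positive_form` there is a
smooth Kähler metric `g` on the real tangent bundle with `g(v, w) = θ(v, Jw)` and Kähler form `θ`.
Voisin (2002), §3.1.1 Lemma 3.3 and (3.1), §3.1.2 Def. 3.6 (same proof as the tree's
`isKaehlerManifold_of_closed_positive_form`). [cite: VoisinHodgeI2002, §3.1.1 Lemma 3.3] -/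
theorem exists_isKaehler_kaehlerForm_eq (θ : MForm 𝓘(ℝ, E) M ℝ 2)
    (hs : IsSmoothForm θ) (hc : IsClosedForm θ)
    (hJ : ∀ (x : M) (v w : TangentSpace 𝓘(ℝ, E) x),
      θ x ![tangentJ E x v, tangentJ E x w] = θ x ![v, w])
    (hp : ∀ (x : M) (v : TangentSpace 𝓘(ℝ, E) x), v ≠ 0 → 0 < θ x ![v, tangentJ E x v]) :
    ∃ g : ContMDiffRiemannianMetric 𝓘(ℝ, E) ∞ E (fun x : M ↦ TangentSpace 𝓘(ℝ, E) x),
      g.toRiemannianMetric.IsKaehler ∧ g.toRiemannianMetric.kaehlerForm = θ ∧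
        ∀ (x : M) (v w : TangentSpace 𝓘(ℝ, E) x), g.inner x v w = θ x ![v, tangentJ E x w] := by
  -- the coefficient forms `g₀ x (v, w) = θ x (v, Jw)`, built on the model fibre `E`
  let g₀ : ∀ x : M, TangentSpace 𝓘(ℝ, E) x →L[ℝ] TangentSpace 𝓘(ℝ, E) x →L[ℝ] ℝ :=
    fun x ↦ (twistBilin (E := E) (θ x :) :)
  have hg₀ : ∀ (x : M) (v w : TangentSpace 𝓘(ℝ, E) x), g₀ x v w = θ x ![v, tangentJ E x w] :=
    fun x v w ↦ rfl
  -- symmetry, from `J`-invariance and antisymmetry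
  have hsymm : ∀ (x : M) (v w : TangentSpace 𝓘(ℝ, E) x), g₀ x v w = g₀ x w v := by
    intro x v w
    rw [hg₀, hg₀, ← hJ x w (tangentJ E x v), tangentJ_tangentJ, cam₂_neg_right,
      cam₂_swap (θ x) (tangentJ E x w) v, neg_neg]
  -- smoothness, in the trivialization at `x₀`
  have hsmooth : ∀ x₀ : M, ContMDiffAt 𝓘(ℝ, E) (𝓘(ℝ, E).prod 𝓘(ℝ, E →L[ℝ] E →L[ℝ] ℝ)) ∞
      (fun x ↦ TotalSpace.mk' (E →L[ℝ] E →L[ℝ] ℝ) x (g₀ x)) x₀ := by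
    intro x₀
    rw [contMDiffAt_section, contMDiffAt_iff_source, contMDiffWithinAt_iff_contDiffWithinAt]
    have hev : ∀ y ∈ (extChartAt 𝓘(ℝ, E) x₀).target,
        ((fun x ↦ (trivializationAt (E →L[ℝ] E →L[ℝ] ℝ)
          (fun x : M ↦ TangentSpace 𝓘(ℝ, E) x →L[ℝ] TangentSpace 𝓘(ℝ, E) x →L[ℝ] ℝ) x₀
            ⟨x, g₀ x⟩).2) ∘ (extChartAt 𝓘(ℝ, E) x₀).symm) y = twistBilin (θ.inChart x₀ y) := by
      intro y hy
      have hx : (extChartAt 𝓘(ℝ, E) x₀).symm y ∈ (chartAt E x₀).source := by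
        rw [← extChartAt_source 𝓘(ℝ, E)]
        exact (extChartAt 𝓘(ℝ, E) x₀).map_target hy
      have hD : mfderivWithin 𝓘(ℝ, E) 𝓘(ℝ, E) (extChartAt 𝓘(ℝ, E) x₀).symm (range 𝓘(ℝ, E)) y =
          (trivializationAt E (TangentSpace 𝓘(ℝ, E)) x₀).symmL ℝ
            ((extChartAt 𝓘(ℝ, E) x₀).symm y) := by
        rw [TangentBundle.symmL_trivializationAt hx, (extChartAt 𝓘(ℝ, E) x₀).right_inv hy]
      ext v w
      simp only [Function.comp_apply, twistBilin_apply]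
      rw [trivializationAt_bilinForm_apply₂, hg₀, ← symmL_trivializationAt_I_smul hx,
        MForm.inChart_apply, hD]
      congr 1
      funext i
      fin_cases i <;> rfl
    refine ((contDiff_twistBilin (E := E)).contDiffAt.comp_contDiffWithinAt _
      (hs x₀)).congr_of_eventuallyEq ?_ (hev _ (mem_extChartAt_target x₀))
    exact Filter.eventuallyEq_of_mem (extChartAt_target_mem_nhdsWithin x₀) hev
  -- the metric
  let g : ContMDiffRiemannianMetric 𝓘(ℝ, E) ∞ E (fun x : M ↦ TangentSpace 𝓘(ℝ, E) x) :=
    { inner := g₀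
      symm := hsymm
      pos := fun x v hv ↦ hp x v hv
      isVonNBounded := fun x ↦ by
        change Bornology.IsVonNBounded ℝ {v : E | twistBilin (E := E) (θ x :) v v < 1}
        obtain ⟨c, hc0, hcv⟩ := exists_pos_mul_norm_sq_le (V := E) (twistBilin (E := E) (θ x :))
          (fun v hv ↦ hp x v hv)
        refine (NormedSpace.isVonNBounded_ball ℝ E (c⁻¹ + 1)).subset ?_
        intro v hv
        rw [Set.mem_setOf_eq] at hv
        rw [Metric.mem_ball, dist_zero_right]
        have h1 : c * ‖v‖ ^ 2 < 1 := (hcv v).trans_lt hv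
        have h2 : ‖v‖ ^ 2 < c⁻¹ := by
          have := mul_lt_mul_of_pos_left h1 (inv_pos.2 hc0)
          rwa [← mul_assoc, inv_mul_cancel₀ hc0.ne', one_mul, mul_one] at this
        by_cases h3 : ‖v‖ ≤ 1
        · have : (0 : ℝ) < c⁻¹ := inv_pos.2 hc0
          linarith
        · push Not at h3
          nlinarith [norm_nonneg v]
      contMDiff := hsmooth }
  -- Hermitian, with Kähler form `θ`
  have hHerm : g.toRiemannianMetric.IsHermitian := by
    intro x v w
    change g₀ x (tangentJ E x v) (tangentJ E x w) = g₀ x v w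
    rw [hg₀, hg₀]
    exact hJ x v (tangentJ E x w)
  have hform : g.toRiemannianMetric.kaehlerForm = θ := by
    funext x
    ext u
    rw [eq_vecCons_two u, Bundle.RiemannianMetric.kaehlerForm_apply_of_isHermitian _ hHerm]
    change g₀ x (tangentJ E x (u 0)) (u 1) = θ x ![u 0, u 1]
    rw [hg₀]
    exact hJ x (u 0) (u 1)
  exact ⟨g, ⟨hHerm, by rw [hform]; exact hc⟩, hform, fun x v w ↦ hg₀ x v w⟩

variable {E' : Type*} [NormedAddCommGroup E'] [NormedSpace ℂ E']
  {M' : Type*} [TopologicalSpace M'] [ChartedSpace E' M'] [IsManifold 𝓘(ℂ, E') ω M']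
  [IsManifold 𝓘(ℝ, E') ∞ M']

/-- **The pull-back of a Kähler metric along a holomorphic immersion is Kähler** (Voisin (2002),
§3.1.3, p. 70: a complex submanifold of a Kähler manifold is Kähler for the induced metric; here
for any `C^∞` map `ψ : M → M'` of complex manifolds whose differential is `ℂ`-linear and
injective). The metric is explicit: `g(v, w) = G(dψ v, dψ w)`; its Kähler form is `ψ^*ω_G`,
closed by naturality of `d` (`mextDeriv_pullback`), of type `(1,1)` and positive, so that
`exists_isKaehler_kaehlerForm_eq` applies. [cite: VoisinHodgeI2002, §3.1.3] -/
theorem exists_isKaehler_inner_eq_pullback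
    (G : ContMDiffRiemannianMetric 𝓘(ℝ, E') ∞ E' (fun y : M' ↦ TangentSpace 𝓘(ℝ, E') y))
    (hG : G.toRiemannianMetric.IsKaehler) {ψ : M → M'} (hψ : ContMDiff 𝓘(ℝ, E) 𝓘(ℝ, E') ∞ ψ)
    (hψJ : ∀ (x : M) (v : TangentSpace 𝓘(ℝ, E) x),
      mfderiv 𝓘(ℝ, E) 𝓘(ℝ, E') ψ x (tangentJ E x v) =
        tangentJ E' (ψ x) (mfderiv 𝓘(ℝ, E) 𝓘(ℝ, E') ψ x v))
    (hψi : ∀ x, Injective (mfderiv 𝓘(ℝ, E) 𝓘(ℝ, E') ψ x)) :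
    ∃ g : ContMDiffRiemannianMetric 𝓘(ℝ, E) ∞ E (fun x : M ↦ TangentSpace 𝓘(ℝ, E) x),
      g.toRiemannianMetric.IsKaehler ∧
        ∀ (x : M) (v w : TangentSpace 𝓘(ℝ, E) x), g.inner x v w =
          G.inner (ψ x) (mfderiv 𝓘(ℝ, E) 𝓘(ℝ, E') ψ x v) (mfderiv 𝓘(ℝ, E) 𝓘(ℝ, E') ψ x w) := by
  set om := G.toRiemannianMetric.kaehlerForm with hω
  have hH : G.toRiemannianMetric.IsHermitian := hG.isHermitian
  have hωs : IsSmoothForm om := G.isSmoothForm_kaehlerForm_toRiemannianMetric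
  set θ : MForm 𝓘(ℝ, E) M ℝ 2 := om.pullback 𝓘(ℝ, E) ψ with hθ
  -- evaluation of `θ` on a pair
  have key : ∀ (x : M) (a b : TangentSpace 𝓘(ℝ, E) x), θ x ![a, b] =
      om (ψ x) ![mfderiv 𝓘(ℝ, E) 𝓘(ℝ, E') ψ x a, mfderiv 𝓘(ℝ, E) 𝓘(ℝ, E') ψ x b] := by
    intro x a b
    rw [hθ, MForm.pullback_apply]
    congr 1
    funext i
    fin_cases i <;> rfl
  have hs : IsSmoothForm θ := Literature.NumberTheory.Transcendental.isSmoothForm_pullback hψ hωs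
  have hc : IsClosedForm θ := by
    show mextDeriv θ = 0
    rw [hθ, Literature.NumberTheory.Transcendental.mextDeriv_pullback hψ hωs]
    have h0 : mextDeriv om = 0 := hG.isClosedForm_kaehlerForm
    rw [h0, MForm.pullback_zero]
  have hJ : ∀ (x : M) (v w : TangentSpace 𝓘(ℝ, E) x),
      θ x ![tangentJ E x v, tangentJ E x w] = θ x ![v, w] := by
    intro x v w
    rw [key, key, hψJ, hψJ, Bundle.RiemannianMetric.kaehlerForm_apply_of_isHermitian _ hH,
      Bundle.RiemannianMetric.kaehlerForm_apply_of_isHermitian _ hH, tangentJ_tangentJ]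
    have := hH (ψ x) (tangentJ E' (ψ x) (mfderiv 𝓘(ℝ, E) 𝓘(ℝ, E') ψ x v))
      (mfderiv 𝓘(ℝ, E) 𝓘(ℝ, E') ψ x w)
    rw [tangentJ_tangentJ] at this
    exact this
  have hp : ∀ (x : M) (v : TangentSpace 𝓘(ℝ, E) x), v ≠ 0 → 0 < θ x ![v, tangentJ E x v] := by
    intro x v hv
    rw [key, hψJ, Bundle.RiemannianMetric.kaehlerForm_apply_of_isHermitian _ hH, hH]
    refine G.pos (ψ x) _ fun h0 ↦ hv ?_
    exact hψi x (by rw [h0, map_zero])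
  obtain ⟨g, hgK, -, hinner⟩ := exists_isKaehler_kaehlerForm_eq θ hs hc hJ hp
  refine ⟨g, hgK, fun x v w ↦ ?_⟩
  rw [hinner, key, hψJ, Bundle.RiemannianMetric.kaehlerForm_apply_of_isHermitian _ hH, hH]
  rfl

end Literature.Geometry.Kaehler
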